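import Summits.BirchSwinnertonDyer.Rank1Residual.X11b.BDPRouteLocalKernelAtP
import Summits.BirchSwinnertonDyer.Rank1Residual.X11b.BDPRouteLocalIndexTransport
import Summits.BirchSwinnertonDyer.Rank1Residual.X11b.BDPRouteLocalIndex
import HarnessLib

/-!
# Class X11b, route p2: Greenberg's Lemma 3.3 above `p`, strict condition, for `E/ℚ` at a
# degree-one `𝔭 ∣ p` — `#ker r_𝔭 ≤ #E(ℚ_p)[p^∞] = p^m`, NO (iv)
# (cell `b2b-bsdres`, sub-cell `multr1-p2`, gen 17)

HONEST FRAMING (verbatim, cell `b2b-bsdres`): the goal of the cell is to DELETE the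
COMBINATION-SHAPED residual classes for ALL analytic-rank `≤ 1` curves over `ℚ` — "full BSD
formula for every rank `≤ 1` curve in class `C`" assembled STRICTLY from published theorems — so
that the rank-`≤ 1` remainder becomes exactly the CONSTRUCTION-SHAPED classes, which are TYPED
(missing-input Props), NOT attempted; this is not "finishing BSD". Research route `p2` for class
X11b; no claim beyond the stated class; nothing booked; X11b stays CONSTRUCTION-SHAPED. Theorems
only; no definition; no named fact; no `sorry`. Continues `BDPRouteLocalKernelAtP.lean` (gen 17).

## Content

* `natCard_primaryComponent_eq_of_addEquiv`, `finite_primaryComponent_of_addEquiv` (plumbing);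
* `finite_primaryComponent_point_padic` — `E(ℚ_p)[p^∞]` is finite (`E⁽²⁾(ℚ_p) ≅ ℤ_p` of finite
  index, Silverman VII.6.3; gen 15 `exists_formalFiltration_two_addEquiv` + `ZpLineIndex.finite_torsion`);
  `exists_natCard_primaryComponent_padic_eq_pow` (`#E(ℚ_p)[p^∞] = p^m`);
* `finite_and_natCard_primaryComponent_adicCompletion_eq_padic` — at a degree-one `𝔭 ∣ p`,
  `#E_K(K_𝔭)[p^∞] = #E(ℚ_p)[p^∞]` (gen 16 transport `pointTransportPadic`);
* **`natCard_localKer_le_natCard_primaryComponent_padic`** — for the globally minimal `W/ℚ`, any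
  number field `K`, ANY `ℤ_p`-extension `κ` and a degree-one `𝔭 ∣ p`:
  `ker r_𝔭 = ker (H¹(K_𝔭, E[p^∞]) → H¹(K_{∞,w}, E[p^∞]))` is finite with `#ker r_𝔭 ≤ #E(ℚ_p)[p^∞]`
  — the factor `#H⁰(K_𝔭, E[p^∞])` of Castella's (calcul). Under (iv) it is `1`; here NO (iv).

CONDITIONAL downstream use only (the control inequality (CTL≤)ᵗ with the strict place counted,
`BDPRouteControlStrictPlace`); nothing booked; labels unchanged.

References: [GreenbergLNM1716] §3 Lemma 3.3 and its proof (p. 87), p. 90; [Castella2018] proof of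
Thm. 2.3, (calcul) (arXiv:1704.06608 p. 6); [SilvermanAEC2009] Prop. VII.6.3.
-/

noncomputable section

open scoped Classical

open NumberField IsDedekindDomain Field WeierstrassCurve
open Literature.NumberTheory.EllipticCurves Literature.NumberTheory.EllipticCurves.GreenbergSelmer
open Literature.NumberTheory.GaloisRepresentations

namespace Summit.BirchSwinnertonDyer.Rank1Residual.X11b.AcSelmer

section Padic

/-- An additive isomorphism preserves the order of `p`-primary components. [folklore] -/
theorem natCard_primaryComponent_eq_of_addEquiv {G H : Type*} [AddCommGroup G] [AddCommGroup H]
    (e : G ≃+ H) (p : ℕ) [Fact p.Prime] :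
    Nat.card (AddCommGroup.primaryComponent G p) = Nat.card (AddCommGroup.primaryComponent H p) := by
  refine Nat.card_congr ⟨fun x ↦ ⟨e x, ?_⟩, fun y ↦ ⟨e.symm y, ?_⟩, fun x ↦ ?_, fun y ↦ ?_⟩
  · obtain ⟨n, hn⟩ := (AddCommGroup.mem_primaryComponent).mp x.2
    exact (AddCommGroup.mem_primaryComponent).mpr ⟨n, by rw [← map_nsmul, hn, map_zero]⟩
  · obtain ⟨n, hn⟩ := (AddCommGroup.mem_primaryComponent).mp y.2
    exact (AddCommGroup.mem_primaryComponent).mpr ⟨n, by rw [← map_nsmul, hn, map_zero]⟩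
  · exact Subtype.ext (e.symm_apply_apply x)
  · exact Subtype.ext (e.apply_symm_apply y)

/-- An additive isomorphism preserves finiteness of `p`-primary components. [folklore] -/
theorem finite_primaryComponent_of_addEquiv {G H : Type*} [AddCommGroup G] [AddCommGroup H]
    (e : G ≃+ H) (p : ℕ) [Fact p.Prime] [Finite (AddCommGroup.primaryComponent H p)] :
    Finite (AddCommGroup.primaryComponent G p) := by
  refine Finite.of_injective (fun x : AddCommGroup.primaryComponent G p ↦
    (⟨e x, ?_⟩ : AddCommGroup.primaryComponent H p)) ?_
  · obtain ⟨n, hn⟩ := (AddCommGroup.mem_primaryComponent).mp x.2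
    exact (AddCommGroup.mem_primaryComponent).mpr ⟨n, by rw [← map_nsmul, hn, map_zero]⟩
  · intro a b hab
    exact Subtype.ext (e.injective (congrArg Subtype.val hab))

variable (W : WeierstrassCurve ℚ) [W.IsElliptic] [W.IsGloballyMinimal] (p : ℕ) [Fact p.Prime]

/-- **`E(ℚ_p)[p^∞]` is finite** (indeed all of `E(ℚ_p)_tors`): `E⁽²⁾(ℚ_p) ≅ ℤ_p` has finite index in
`E(ℚ_p)` (Silverman VII.6.3; gen 15 `exists_formalFiltration_two_addEquiv`, `ZpLineIndex.finite_torsion`).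
[cite: SilvermanAEC2009, Prop. VII.6.3] -/
theorem finite_primaryComponent_point_padic :
    Finite (AddCommGroup.primaryComponent (W.baseChange ℚ_[p]).toAffine.Point p) := by
  haveI := (W.baseChange ℚ_[p]).finiteIndex_formalFiltration 2
  obtain ⟨φ, -⟩ := LocalIndex.exists_formalFiltration_two_addEquiv (W.baseChange ℚ_[p])
  haveI : Finite (AddCommGroup.torsion (W.baseChange ℚ_[p]).toAffine.Point) :=
    LocalIndex.finite_torsion ((W.baseChange ℚ_[p]).formalFiltration 2) φ
  refine Finite.of_injective (fun x : AddCommGroup.primaryComponent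
      (W.baseChange ℚ_[p]).toAffine.Point p ↦
    (⟨(x : (W.baseChange ℚ_[p]).toAffine.Point), ?_⟩ :
      AddCommGroup.torsion (W.baseChange ℚ_[p]).toAffine.Point)) ?_
  · obtain ⟨n, hn⟩ := (AddCommGroup.mem_primaryComponent).mp x.2
    exact (AddCommGroup.mem_torsion _).mpr (isOfFinAddOrder_iff_nsmul_eq_zero.mpr
      ⟨p ^ n, pow_pos (Fact.out : p.Prime).pos n, hn⟩)
  · intro a b hab
    exact Subtype.ext (by
      simpa using congrArg (fun z : AddCommGroup.torsion (W.baseChange ℚ_[p]).toAffine.Point ↦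
        (z : (W.baseChange ℚ_[p]).toAffine.Point)) hab)

/-- `#E(ℚ_p)[p^∞] = p^m` for some `m` (a finite `p`-primary group). [folklore] -/
theorem exists_natCard_primaryComponent_padic_eq_pow :
    ∃ m : ℕ, Nat.card (AddCommGroup.primaryComponent (W.baseChange ℚ_[p]).toAffine.Point p) =
      p ^ m := by
  haveI := finite_primaryComponent_point_padic W p
  have hPG : IsPGroup p (Multiplicative
      (AddCommGroup.primaryComponent (W.baseChange ℚ_[p]).toAffine.Point p)) := fun g ↦ by
    obtain ⟨m, hm⟩ := (AddCommGroup.mem_primaryComponent).mp (Multiplicative.toAdd g).2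
    refine ⟨m, ?_⟩
    apply Multiplicative.toAdd.injective
    rw [toAdd_pow, toAdd_one]
    exact Subtype.ext (by rw [AddSubmonoidClass.coe_nsmul, hm]; rfl)
  obtain ⟨m, hm⟩ := IsPGroup.iff_card.mp hPG
  exact ⟨m, hm⟩

variable {K : Type} [Field K] [NumberField K] (κ : ZpExtension K p) (𝔭 : HeightOneSpectrum (𝓞 K))

/-- At a degree-one `𝔭 ∣ p`: `#E_K(K_𝔭)[p^∞] = #E(ℚ_p)[p^∞]` and both are finite (transport of points
along `K_𝔭 ≃ ℚ_p`, gen 16 `pointTransportPadic`). [folklore] -/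
theorem finite_and_natCard_primaryComponent_adicCompletion_eq_padic
    (h𝔭 : ((p : ℕ) : 𝓞 K) ∈ 𝔭.asIdeal) (he : 𝔭.asIdeal.ramificationIdx (𝓞 ℚ) = 1)
    (hf : 𝔭.asIdeal.inertiaDeg (𝓞 ℚ) = 1) :
    Finite (AddCommGroup.primaryComponent
        ((W.baseChange K).baseChange (𝔭.adicCompletion K)).toAffine.Point p) ∧
      Nat.card (AddCommGroup.primaryComponent
          ((W.baseChange K).baseChange (𝔭.adicCompletion K)).toAffine.Point p) =
        Nat.card (AddCommGroup.primaryComponent (W.baseChange ℚ_[p]).toAffine.Point p) := by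
  haveI := finite_primaryComponent_point_padic W p
  let e := LocalIndexTransport.pointTransportPadic K p 𝔭 h𝔭 he hf W
  exact ⟨finite_primaryComponent_of_addEquiv e p, natCard_primaryComponent_eq_of_addEquiv e p⟩

/-- **Greenberg's Lemma 3.3 above `p` for `E/ℚ` over a number field, strict condition, NO (iv):
`#ker r_𝔭 ≤ #E(ℚ_p)[p^∞]`.** For the globally minimal elliptic `W/ℚ`, a number field `K`, ANY
`ℤ_p`-extension `κ` of `K` and a prime `𝔭 ∣ p` of `K` of degree one (`K_𝔭 ≅ ℚ_p`): the local kernel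
`ker (H¹(K_𝔭, E[p^∞]) → H¹(K_{∞,w}, E[p^∞]))` at the chosen place `w ∣ 𝔭` of `K_∞ = K̄^{ker κ}` is
finite of order at most `#E(ℚ_p)[p^∞]` (`= #H⁰(K_𝔭, E[p^∞])`, the factor of Castella's (calcul)).
Under (iv) this kernel is `0` (multr1-p1 gen 10); in general it is what the control inequality
(CTL≤)ᵗ pays at the strict place, repaid by the same factor in the Selmer count.
[cite: GreenbergLNM1716, §3 Lemma 3.3 and its proof (p. 87), p. 90]
[cite: Castella2018, proof of Thm. 2.3, (calcul) (arXiv:1704.06608 p. 6), the factor `#H⁰(K_𝔭, E[p^∞])`] -/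
theorem natCard_localKer_le_natCard_primaryComponent_padic
    (h𝔭 : ((p : ℕ) : 𝓞 K) ∈ 𝔭.asIdeal) (he : 𝔭.asIdeal.ramificationIdx (𝓞 ℚ) = 1)
    (hf : 𝔭.asIdeal.inertiaDeg (𝓞 ℚ) = 1) :
    Finite (localKer κ.kerSubgroup ((W.baseChange K).geomPrimaryTorsion p) 𝔭) ∧
      Nat.card (localKer κ.kerSubgroup ((W.baseChange K).geomPrimaryTorsion p) 𝔭) ≤
        Nat.card (AddCommGroup.primaryComponent (W.baseChange ℚ_[p]).toAffine.Point p) := by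
  haveI hEK : (W.baseChange K).IsElliptic := by rw [baseChange]; infer_instance
  obtain ⟨hfinv, hcard⟩ :=
    finite_and_natCard_primaryComponent_adicCompletion_eq_padic W p 𝔭 h𝔭 he hf
  haveI := hfinv
  obtain ⟨hfinK, hK⟩ := natCard_localKer_le_natCard_primaryComponent (W.baseChange K) p κ 𝔭
  exact ⟨hfinK, hK.trans hcard.le⟩

end Padic

end Summit.BirchSwinnertonDyer.Rank1Residual.X11b.AcSelmer

end
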